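import Literature.Geometry.DiscreteGeometry.PolyCert

/-!
# Certificate format and kernel-evaluable checker for the three-point bound on `S³`

The *computational* half of the certificate checker for the Bachoc–Vallentin semidefinite
(three-point) bound for the kissing number in four dimensions (BV 2008, Theorem 4.2 with `n = 4`,
`d = N = 7`): plain `List`/`ℤ` programs on the sparse trivariate term lists `SPoly` of `PolyCert`,
evaluated by the kernel (`decide`) on the data of `KissingCertData{A,B,C}`.  Their *meaning*
(evaluation lemmas) and the soundness theorem `card_le_of_cert` are in `KissingCertDefs`; this
file deliberately imports nothing but `PolyCert`, so that the data files and the expensive kernel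
validations (`KissingCertExpand*`) do not depend on the analytic part of the library.

Contents:
* sorted normal form of term lists through an MSB-first trie (`normalize`), sorted product `mulN`;
* reflective Chebyshev / Legendre / `QkP` tables (`chebUPoly`, `legendreIPoly`, `QkPPoly`,
  `symTab`), the reflective three-point part `FPoly` of a block list `List FBlk`
  (`F = Σ_blocks Σ_w sym6 (φ_w(u) φ_w(v) QkP k)`), and the two-point part `APoly`
  (`A = Σ_k a_k U_{k}`);
* Gram blocks `GramBlk = (z, L)` and the quadratic form `zᵀ(LLᵀ)z` (`quadL`), with a row-chunked
  variant `quadRows`/`chunkOK` (bounded kernel memory per chunk) and the block-chunked `FchunkOK`;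
* the certificate record `Cert` (dyadic scalars `a_k, b_ij`, `F` blocks, slacks), the claimed
  expansions `CertPolys`, and the Boolean checks `checkI` (`(i')`:
  `-1 - A(s) - 2b₁₂ - b₂₂ - 3F(s,s,1) = q + (1+s)(1-2s) q₁ + c₀ + ρ`), `checkII` (`(ii')`:
  `-b₂₂ - F = r + Σ_x (1+x)(1-2x) r_x + (1+2uvt-u²-v²-t²) r₄ + c₀ + ρ`, `Σ|ρ| ≤ c₀`),
  `checkSide` (signs and scales) and `checkBound` (`1 + A(1) + b₁₁ + F(1,1,1) < 25`).

## References
* C. Bachoc, F. Vallentin, *New upper bounds for kissing numbers from semidefinite programming*,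
  J. Amer. Math. Soc. 21 (2008), Theorem 4.2, §5. [`BachocVallentin2007`]
-/

noncomputable section

namespace Literature.Geometry.DiscreteGeometry

open PolyCert PolyCert.SPoly

namespace PolyCert

/-! ### Sorted normalisation through an MSB-first trie -/

/-- Lexicographic key (`a` major). [folklore] -/
def Mono.keyM (m : Mono) : ℕ := m.a * 1024 + m.b * 32 + m.c

namespace CTree

/-- Insert following the bits of `key` from the most significant of `depth` bits. [folklore] -/
def insM : ℕ → ℕ → Mono → ℤ → CTree → Option CTree
  | 0, _, m, c, empty => some (leaf m c)
  | 0, _, m, c, leaf m' c' => if m = m' then some (leaf m (c' + c)) else none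
  | 0, _, _, _, node _ _ => none
  | _ + 1, _, _, _, leaf _ _ => none
  | d + 1, key, m, c, empty =>
      if (key / 2 ^ d) % 2 = 0 then (insM d key m c empty).map fun l => node l empty
      else (insM d key m c empty).map fun r => node empty r
  | d + 1, key, m, c, node l r =>
      if (key / 2 ^ d) % 2 = 0 then (insM d key m c l).map fun l' => node l' r
      else (insM d key m c r).map fun r' => node l r'

/-- Insert all terms (MSB-first, 15 bits). [folklore] -/
def insAllM : SPoly → CTree → Option CTree
  | [], tr => some tr
  | (m, c) :: rest, tr =>
    match insM 15 m.keyM m c tr with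
    | none => none
    | some tr' => insAllM rest tr'

/-- In-order list of leaves. [folklore] -/
def toSPoly : CTree → SPoly
  | empty => []
  | leaf m c => [(m, c)]
  | node l r => toSPoly l ++ toSPoly r

end CTree

namespace SPoly

/-- Sorted normal form (duplicates merged, lexicographic order); identity on collision. [folklore] -/
def normalize (p : SPoly) : SPoly :=
  match CTree.insAllM p CTree.empty with
  | some tr => tr.toSPoly
  | none => p

/-- Product keeping sortedness of the second factor (merge of shifted copies). [folklore] -/
def mulN (p q : SPoly) : SPoly := mergeAll (p.map fun mc => mulMono mc.1 mc.2 q)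

/-- Sum of coefficients = value at `(1,1,1)`. [folklore] -/
def coeffSum (p : SPoly) : ℤ := (p.map fun mc => mc.2).sum

/-! ### Reflective special polynomials -/

/-- `chebUh` on term lists. [folklore] -/
def chebUhPoly : ℕ → SPoly → SPoly → SPoly
  | 0, _, _ => C 1
  | 1, Tp, _ => Tp
  | k + 2, Tp, Dp => normalize (mulN Tp (chebUhPoly (k + 1) Tp Dp) ++ neg (mulN Dp (chebUhPoly k Tp Dp)))

/-- The Chebyshev polynomial `U_k(u)` as a term list. [folklore] -/
def chebUPoly (k : ℕ) : SPoly := normalize (chebUhPoly k (smul 2 U) (C 1))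

/-- `legendreI` on term lists. [folklore] -/
def legendreIPoly (k : ℕ) (Sp Qp : SPoly) : SPoly :=
  lsum ((List.range (k / 2 + 1)).map fun j =>
    smul ((-1) ^ j * (k.choose j : ℤ) * ((2 * k - 2 * j).choose k : ℤ)) (mul (pow Sp (k - 2 * j)) (pow Qp j)))

/-- `QkP k` as a (sorted, normalised) term list. [folklore] -/
def QkPPoly (k : ℕ) : SPoly :=
  normalize (legendreIPoly k (T ++ neg (mul U V)) (mul (C 1 ++ neg (mul U U)) (C 1 ++ neg (mul V V))))

/-- `u^a v^b QkP k` as a term list. [folklore] -/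
def baseTab (k a b : ℕ) : SPoly := normalize (mulN [(⟨a, b, 0⟩, 1)] (QkPPoly k))

/-- `sym6 (u^a v^b QkP k)` as a sorted term list. [folklore] -/
def symTab (k a b : ℕ) : SPoly :=
  normalize (baseTab k a b ++ permBAC (baseTab k a b) ++ permACB (baseTab k a b) ++
    permCBA (baseTab k a b) ++ permCAB (baseTab k a b) ++ permBCA (baseTab k a b))

/-- Decode a flat integer list `[a, b, c, coef, a, b, c, coef, …]` into an `SPoly`
(compact encoding of certificate data). [folklore] -/
def ofFlat : List ℤ → SPoly
  | a :: b :: c :: co :: rest => (⟨a.toNat, b.toNat, c.toNat⟩, co) :: ofFlat rest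
  | _ => []

end SPoly

end PolyCert

/-! ### The three-point part `F` -/

/-- A block of the three-point part: degree `k` and integer weight vectors. [folklore] -/
structure FBlk where
  /-- degree of the kernel `QkP k` -/
  k : ℕ
  /-- weight vectors (coefficients of `φ_w(u) = Σ_a w_a u^a`) -/
  ws : List (List ℤ)

namespace PolyCert.SPoly

/-- One weight vector: `Σ_{a,b} (w_a w_b) · symTab k a b`. [folklore] -/
def FwPoly (k : ℕ) (w : List ℤ) : SPoly :=
  mergeAll ((List.range w.length).map fun a => mergeAll ((List.range w.length).map fun b' =>
    smul (w.getD a 0 * w.getD b' 0) (symTab k a b')))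

/-- One block. [folklore] -/
def FbPoly (b : FBlk) : SPoly := mergeAll (b.ws.map (FwPoly b.k))

/-- Reflective form of `F`: `Σ_blocks Σ_w Σ_{a,b} (w_a w_b) · symTab k a b`. [folklore] -/
def FPoly (bs : List FBlk) : SPoly := mergeAll (bs.map FbPoly)

end PolyCert.SPoly

/-! ### The two-point part `A` -/

namespace PolyCert.SPoly

/-- Reflective form of `A`. [folklore] -/
def APoly (as : List ℤ) : SPoly :=
  mergeAll ((List.range as.length).map fun k => smul (as.getD k 0) (chebUPoly (k + 1)))

/-! ### Balanced merging (logarithmic nesting depth for kernel evaluation) -/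

/-- Merge adjacent pairs. [folklore] -/
def mergePairs : List SPoly → List SPoly
  | p :: q :: rest => mergeAdd (p.length + q.length) p q :: mergePairs rest
  | ps => ps

/-- Balanced merge of a list of term lists (fuel = number of halving rounds). [folklore] -/
def mergeAllB : ℕ → List SPoly → SPoly
  | 0, ps => lsum ps
  | _ + 1, [] => []
  | _ + 1, [p] => p
  | k + 1, p :: q :: rest => mergeAllB k (mergePairs (p :: q :: rest))

/-- The quadratic form `Σ_{i,j<n} G_{ij} z_i z_j` with balanced merging. [folklore] -/
def quadMonoB (G : List (List ℤ)) (z : List Mono) (n : ℕ) : SPoly :=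
  mergeAllB 16 ((List.range n).map fun i =>
    (List.range n).map fun j => ((getMono z i).mul (getMono z j), getEntry G i j))

/-! ### Gram blocks and the two checks -/

/-- A Gram block: basis monomials `z` and an integer factor `L` (rows) with `G = L Lᵀ`. [folklore] -/
structure GramBlk where
  /-- basis monomials -/
  z : List Mono
  /-- rows of the factor `L` -/
  L : List (List ℤ)

/-- Maximal row length. [folklore] -/
def maxLen (L : List (List ℤ)) : ℕ := (L.map List.length).foldr max 0

/-- Accumulator dot product (kernel-friendly: no intermediate lists). [folklore] -/
def dotAcc : List ℤ → List ℤ → ℤ → ℤ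
  | x :: a, y :: b, acc => dotAcc a b (acc + x * y)
  | _, _, acc => acc

/-- `L Lᵀ` as a list of rows (direct double map; no indexing). [folklore] -/
def gramRows (L : List (List ℤ)) : List (List ℤ) := L.map fun ri => L.map fun rj => dotAcc ri rj 0

/-- The quadratic form `Σ_{i,j} G_{ij} z_i z_j`, iterating over the rows of `G` zipped with `z`
(balanced merging). [folklore] -/
def quadZip (G : List (List ℤ)) (z : List Mono) : SPoly :=
  mergeAllB 16 (List.zipWith (fun (row : List ℤ) (zi : Mono) =>
    List.zipWith (fun (g : ℤ) (zj : Mono) => (zi.mul zj, g)) row z) G z)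

/-- The quadratic form `zᵀ (L Lᵀ) z` of a Gram block. [folklore] -/
def quadL (g : GramBlk) : SPoly := quadZip (gramRows g.L) g.z

/-- Length side condition of a Gram block. [folklore] -/
def GramBlk.lenOK (g : GramBlk) : Bool := g.L.length == g.z.length

/-! ### Row-chunked evaluation of the Gram quadratic form (bounded kernel memory per chunk) -/

/-- Rows `i0, …, i0+cnt-1` of the quadratic form `zᵀ(LLᵀ)z`. [folklore] -/
def quadRows (g : GramBlk) (i0 cnt : ℕ) : SPoly :=
  mergeAllB 16 (List.zipWith (fun (ri : List ℤ) (zi : Mono) =>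
      List.zipWith (fun (g' : ℤ) (zj : Mono) => (zi.mul zj, g')) (g.L.map fun rj => dotAcc ri rj 0) g.z)
    ((g.L.drop i0).take cnt) ((g.z.drop i0).take cnt))

/-- Chunk check: `Dprev + (rows i0 … i0+cnt-1) - Dnext ≡ 0` on the box. [folklore] -/
def chunkOK (g : GramBlk) (i0 cnt : ℕ) (Dprev Dnext : SPoly) : Bool :=
  g.lenOK && decide (i0 + cnt ≤ g.z.length) && residualBound (Dprev ++ quadRows g i0 cnt ++ neg Dnext) 0

/-- The multiplier `(1+u)(1-2u) = 1 - u - 2u²`. [folklore] -/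
def ptU : SPoly := [(⟨0, 0, 0⟩, 1), (⟨1, 0, 0⟩, -1), (⟨2, 0, 0⟩, -2)]
/-- The multiplier `(1+v)(1-2v)`. [folklore] -/
def ptV : SPoly := [(⟨0, 0, 0⟩, 1), (⟨0, 1, 0⟩, -1), (⟨0, 2, 0⟩, -2)]
/-- The multiplier `(1+t)(1-2t)`. [folklore] -/
def ptT : SPoly := [(⟨0, 0, 0⟩, 1), (⟨0, 0, 1⟩, -1), (⟨0, 0, 2⟩, -2)]
/-- The multiplier `1 + 2uvt - u² - v² - t²`. [folklore] -/
def p4 : SPoly := [(⟨0, 0, 0⟩, 1), (⟨0, 0, 2⟩, -1), (⟨0, 2, 0⟩, -1), (⟨1, 1, 1⟩, 2), (⟨2, 0, 0⟩, -1)]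

/-- The certificate (scalars, `F` data and Gram factors). [folklore] -/
structure Cert where
  /-- binary scale of `a_k`, `b_ij` -/
  S : ℕ
  /-- binary scale of the weight vectors of `F` (`F = F_int / 4^Sp`) -/
  Sp : ℕ
  /-- binary scale of the Gram factors (`identity × 4^Spp`) -/
  Spp : ℕ
  /-- numerators of `a_1, …, a_d` -/
  A : List ℤ
  /-- numerator of `b₁₁` -/
  B11 : ℤ
  /-- numerator of `b₁₂` -/
  B12 : ℤ
  /-- numerator of `b₂₂` -/
  B22 : ℤ
  /-- the three-point part -/
  F : List FBlk
  /-- slack numerator of `(ii')` -/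
  c0 : ℕ
  /-- slack numerator of `(i')` -/
  c01 : ℕ

/-- Expanded polynomial data accompanying a certificate: the (claimed) expansions of `F` and of
the Gram quadratic forms; they are validated semantically (`FexpValid`, `QuadOK3`). [folklore] -/
structure CertPolys where
  /-- expansion of `F_int` -/
  FP : SPoly
  /-- expansion `zᵀ(LLᵀ)z` of the Gram block `r` of `(ii')` (multiplier `1`) -/
  Rr : SPoly
  /-- expansion of the Gram block `r_u` of `(ii')` (multiplier `(1+u)(1-2u)`) -/
  Ru : SPoly
  /-- expansion of the Gram block `r_v` of `(ii')` (multiplier `(1+v)(1-2v)`) -/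
  Rv : SPoly
  /-- expansion of the Gram block `r_t` of `(ii')` (multiplier `(1+t)(1-2t)`) -/
  Rt : SPoly
  /-- expansion of the Gram block `r_4` of `(ii')` (multiplier `1+2uvt-u²-v²-t²`) -/
  R4 : SPoly
  /-- expansion of the Gram block `q` of `(i')` (multiplier `1`) -/
  Qq : SPoly
  /-- expansion of the Gram block `q_1` of `(i')` (multiplier `(1+s)(1-2s)`) -/
  Qq1 : SPoly

/-- Semantic validation of an `F` expansion: `FPoly F - FP` vanishes identically (on the box).
[folklore] -/
def FexpOK (F : List FBlk) (FP : SPoly) : Bool := residualBound (FPoly F ++ neg FP) 0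

/-- Semantic validation of a Gram expansion: `quadL g - R` vanishes identically. [folklore] -/
def quadExpOK (g : GramBlk) (R : SPoly) : Bool := g.lenOK && residualBound (quadL g ++ neg R) 0

/-- Block-chunk check for `F`: `Dprev + FPoly bs - Dnext ≡ 0` on the box. [folklore] -/
def FchunkOK (bs : List FBlk) (Dprev Dnext : SPoly) : Bool :=
  residualBound (Dprev ++ FPoly bs ++ neg Dnext) 0

/-- Target of `(ii')` in integer units: `-(2^{2Spp-S} B22 + 2^{2Spp-2Sp} F_int)`. [folklore] -/
def targetII (c : Cert) (P : CertPolys) : SPoly :=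
  neg (C (2 ^ (2 * c.Spp - c.S) * c.B22) ++ smul (2 ^ (2 * c.Spp - 2 * c.Sp)) P.FP)

/-- Sum-of-squares side of `(ii')`. [folklore] -/
def rhsII (P : CertPolys) : SPoly :=
  mergeAll [P.Rr, mulN ptU P.Ru, mulN ptV P.Rv, mulN ptT P.Rt, mulN p4 P.R4]

/-- The check of `(ii')`: `|targetII - rhsII - c0| ≤ c0` coefficientwise-summed. [folklore] -/
def checkII (c : Cert) (P : CertPolys) : Bool :=
  residualBound (mergeAll [targetII c P, neg (rhsII P), neg (C c.c0)]) c.c0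

/-- Target of `(i')` in integer units:
`-(4^{Spp} + 2^{2Spp-S} A_int(s) + 2^{2Spp-S}(2B12+B22) + 3·2^{2Spp-2Sp} F_int(s,s,1))`. [folklore] -/
def targetI (c : Cert) (P : CertPolys) : SPoly :=
  neg (C (2 ^ (2 * c.Spp)) ++ smul (2 ^ (2 * c.Spp - c.S)) (APoly c.A) ++
    C (2 ^ (2 * c.Spp - c.S) * (2 * c.B12 + c.B22)) ++
      smul (3 * 2 ^ (2 * c.Spp - 2 * c.Sp)) (substUU1 P.FP))

/-- Sum-of-squares side of `(i')`. [folklore] -/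
def rhsI (P : CertPolys) : SPoly := mergeAll [P.Qq, mulN ptU P.Qq1]

/-- The check of `(i')`. [folklore] -/
def checkI (c : Cert) (P : CertPolys) : Bool :=
  residualBound (mergeAll [targetI c P, neg (rhsI P), neg (C c.c01)]) c.c01

/-- Side conditions: scales consistent, `a_k ≥ 0` (and at most 9 of them), `b ⪰ 0`. [folklore] -/
def checkSide (c : Cert) : Bool :=
  decide (c.S ≤ 2 * c.Spp) && decide (2 * c.Sp ≤ 2 * c.Spp) && decide (c.A.length ≤ 9) &&
  (c.A.all fun a => decide (0 ≤ a)) &&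
  decide (0 ≤ c.B11) && decide (0 < c.B22) && decide (c.B12 * c.B12 ≤ c.B11 * c.B22)

/-! ### The numerical value of the bound -/

/-- Integer test `0 ≤ 1 + A(1) + b₁₁ + F(1,1,1) < 25`, using the expansion `FP`. [folklore] -/
def checkBound (c : Cert) (P : CertPolys) : Bool :=
  decide (4 ^ c.Sp * (2 ^ c.S + coeffSum (APoly c.A) + c.B11) + 2 ^ c.S * coeffSum P.FP
      < 25 * 2 ^ c.S * 4 ^ c.Sp) &&
  decide (0 ≤ 4 ^ c.Sp * (2 ^ c.S + coeffSum (APoly c.A) + c.B11) + 2 ^ c.S * coeffSum P.FP)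

end PolyCert.SPoly

end Literature.Geometry.DiscreteGeometry

end
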